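import Summits.BirchSwinnertonDyer.BirchSwinnertonDyer.Theorems.PrintX8VerticalStevensBridgeEll
import Literature.NumberTheory.EllipticCurves.ModPReducibilityProofs
import Literature.NumberTheory.EllipticCurves.CuspFormLFunctionLevelConductorProofs
import Literature.NumberTheory.EllipticCurves.Rank1Residual.Predicates
import HarnessLib

/-!
# Route `PrintX8` (and the X9/X10 lanes of `bsd-f3-mu`) — the bridge under «`E[p]` IRREDUCIBLE» instead of
# «`a_p ≢ 1 (mod p)`»: span statement + `E[p]` irreducible + `p` odd good ⟹ `CycWindingNonConstantAt W p`

Cell `bsd-print-x8`, seat p1 (gen 4), `--supports stmt-BirchSwinnertonDyer-20622`.  Theorems only; route-independent;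
no named fact is taken as a hypothesis: `E[p]` irreducible gives a prime `ℓ ≠ p` of good reduction with
`a_ℓ(E) ≢ ℓ + 1 (mod p)` by the tree THEOREM `not_irreducible_of_frobeniusTrace_congr_holds` (Chebotarev +
Brauer–Nesbitt), and the `ℓ`-Hecke bridge `exists_mem_one_le_norm_sub_of_spanModBy_of_prime` does the rest.  This is
bsd-f3-mu MEMO-an §13.3 COROLLARY C / AN-9 `CycWindingNonConstancyOddIrreducible` made a kernel theorem MODULO the
group-theoretic span statement (their THEOREM B), displayed as a hypothesis in three spellings (`EisSpanModGen`,
`EisSpanGen`, `ConjSpanGen` at the levels prime to `p`).  It covers the ordinary ANOMALOUS primes (`a_p ≡ 1`) that the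
`a_p ≢ 1` form (`PrintX8VerticalStevensSpan.cycWindingNonConstantAt_of_spanMod`) misses.
-/

-- the summit namespace repeats `BirchSwinnertonDyer` by design (summit = problem); linter moot
set_option linter.dupNamespace false
set_option autoImplicit false

noncomputable section

namespace Summit.BirchSwinnertonDyer.BirchSwinnertonDyer.Theorems.PrintX8VerticalStevens

open scoped MatrixGroups ModularForm

open CongruenceSubgroup Matrix Matrix.SpecialLinearGroup WeierstrassCurve
  Literature.NumberTheory.EllipticCurves Literature.NumberTheory.EllipticCurves.ModularForms
  Literature.NumberTheory.EllipticCurves.Rank1Residual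

section Level

variable {N : ℕ} [NeZero N] {f : CuspForm (Gamma0 N) 2} {p : ℕ} [Fact p.Prime]

/-- **Level form**: a rational newform `f` on `Γ₀(N)`, `p` odd, ONE prime `ℓ ∤ N` with `a_ℓ(f) ≢ ℓ + 1 (mod p)`,
and the mod-`p` span statement `EisSpanModGen N p` ⟹ the plus symbol of `f` is non-constant mod `p` on `ℤ[1/p]`
(some `[a/pⁿ]⁺ − [a'/pⁿ]⁺` has norm `≥ 1`; here `a' = 0`). -/
theorem exists_one_le_norm_sub_of_spanMod_of_prime (hf : IsNewform0 f) (hQ : coeffField f = ⊥) (hp2 : p ≠ 2)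
    {ℓ : ℕ} [Fact ℓ.Prime] (hℓN : ¬ ℓ ∣ N) {aℓ : ℤ} (haℓ : cuspCoeff f ℓ = aℓ)
    (haℓ1 : ¬ (p : ℤ) ∣ aℓ - (ℓ + 1)) (hspan : EisSpanModGen N p) :
    ∃ (n : ℕ) (a a' : ℤ),
      1 ≤ ‖((ratPlusSymbol f ((a : ℚ) / (p : ℚ) ^ n) - ratPlusSymbol f ((a' : ℚ) / (p : ℚ) ^ n) : ℚ) :
        ℚ_[p])‖ := by
  have hp : p.Prime := Fact.out
  obtain ⟨γ, ⟨k, hk⟩, hunit⟩ := exists_mem_one_le_norm_sub_of_spanModBy_of_prime hf hQ hp2 hℓN haℓ haℓ1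
    {γ : Gamma0 N | IsGoodAt p γ} ((spanModBy_setOf_isGoodAt_iff N p).mpr hspan)
  have hd : ((γ : SL(2, ℤ)) 1 1 : ℤ) = (p : ℤ) ^ k ∨ ((γ : SL(2, ℤ)) 1 1 : ℤ) = -((p : ℤ) ^ k) := by
    have := Int.natAbs_eq_iff.mp hk
    push_cast at this
    simpa [dEntry] using this
  have h0 : ((0 : ℤ) : ℚ) / (p : ℚ) ^ k = 0 := by simp
  rcases hd with hd | hd
  · refine ⟨k, ((γ : SL(2, ℤ)) 0 1 : ℤ), 0, ?_⟩
    have e : (((γ : SL(2, ℤ)) 0 1 : ℤ) : ℚ) / (p : ℚ) ^ k =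
        (((γ : SL(2, ℤ)) 0 1 : ℤ) : ℚ) / (((γ : SL(2, ℤ)) 1 1 : ℤ) : ℚ) := by
      rw [hd]; push_cast; rfl
    rw [h0, e]
    exact hunit
  · refine ⟨k, -((γ : SL(2, ℤ)) 0 1 : ℤ), 0, ?_⟩
    have e : (((-((γ : SL(2, ℤ)) 0 1 : ℤ) : ℤ)) : ℚ) / (p : ℚ) ^ k =
        (((γ : SL(2, ℤ)) 0 1 : ℤ) : ℚ) / (((γ : SL(2, ℤ)) 1 1 : ℤ) : ℚ) := by
      rw [hd]; push_cast; rw [div_neg, neg_div]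
    rw [h0, e]
    exact hunit

end Level

section Curves

variable (W : WeierstrassCurve ℚ) [W.IsElliptic] [W.IsGloballyMinimal] (p : ℕ) [Fact p.Prime]

/-- **The bridge under irreducibility** (bsd-f3-mu COROLLARY C / AN-9, modulo the span statement): for an
elliptic curve `E/ℚ`, an odd prime `p` of good reduction with `E[p]` IRREDUCIBLE, and the mod-`p` span statement
`EisSpanModGen M p` at every level `M` prime to `p`: `CycWindingNonConstantAt W p`.  (`E[p]` irreducible ⟹ some good
`ℓ ≠ p` with `a_ℓ(E) ≢ ℓ + 1 (mod p)`, `not_irreducible_of_frobeniusTrace_congr_holds`; then the `ℓ`-Hecke bridge.)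
No `a_p ≢ 1` hypothesis: anomalous ordinary primes are covered. -/
theorem cycWindingNonConstantAt_of_irreducible_of_spanMod (hp2 : p ≠ 2) (hgood : W.HasGoodReductionAtPrime p)
    (hirr : W.HasIrreducibleModPGaloisRep p)
    (hspan : ∀ (M : ℕ), 0 < M → ¬ p ∣ M → EisSpanModGen M p) :
    CycWindingNonConstantAt W p := by
  intro M _ f hf
  have hp : p.Prime := Fact.out
  have hpM : ¬ p ∣ M := not_dvd_level_of_isNewformOf hf hgood
  obtain ⟨ℓ, _, -, hgoodℓ, hℓ1⟩ :=
    exists_prime_not_dvd_frobeniusTrace_sub not_irreducible_of_frobeniusTrace_congr_holds W p hirr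
  have hℓM : ¬ ℓ ∣ M := not_dvd_level_of_isNewformOf hf hgoodℓ
  exact exists_one_le_norm_sub_of_spanMod_of_prime hf.1 hf.coeffField_eq_bot hp2 hℓM
    (cuspCoeff_eq_frobeniusTrace_of_isNewformOf_holds hf hgoodℓ) hℓ1 (hspan M (NeZero.pos M) hpM)

/-- The same from **EIS-SPAN** (`EisSpanGen M p`) at every level prime to `p`. -/
theorem cycWindingNonConstantAt_of_irreducible_of_eisSpanGen (hp2 : p ≠ 2)
    (hgood : W.HasGoodReductionAtPrime p) (hirr : W.HasIrreducibleModPGaloisRep p)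
    (hE : ∀ (M : ℕ), 0 < M → ¬ p ∣ M → EisSpanGen M p) :
    CycWindingNonConstantAt W p :=
  cycWindingNonConstantAt_of_irreducible_of_spanMod W p hp2 hgood hirr
    fun M hM hpM ↦ eisSpanModGen_of_eisSpanGen Fact.out (hE M hM hpM)

/-- The same from **CONJ-SPAN** (`ConjSpanGen M p`, = bsd-f3-mu's THEOREM B) at every level prime to `p`:
MEMO-an §13.3 COROLLARY C «`E/ℚ`, `p` odd of good reduction, `E[p]` irreducible ⟹ `CycWindingNonConstantAt W p`»
modulo THEOREM B at the prime `p`. -/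
theorem cycWindingNonConstantAt_of_irreducible_of_conjSpanGen (hp2 : p ≠ 2)
    (hgood : W.HasGoodReductionAtPrime p) (hirr : W.HasIrreducibleModPGaloisRep p)
    (hC : ∀ (M : ℕ), 0 < M → ¬ p ∣ M → ConjSpanGen M p) :
    CycWindingNonConstantAt W p :=
  cycWindingNonConstantAt_of_irreducible_of_eisSpanGen W p hp2 hgood hirr
    fun M hM hpM ↦ eisSpanGen_of_conjSpanGen (Nat.Prime.one_lt Fact.out).ne' (hC M hM hpM)

omit [Fact p.Prime] in
/-- **AN-9 shape** (bsd-f3-mu `CycWindingNonConstancyOddIrreducible`, class-wide, all curves and all odd good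
primes at once) **modulo THEOREM B for all levels and primes** (displayed as `hB`). -/
theorem cycWindingNonConstancyOddIrreducible_of_conjSpanGenAll
    (hB : ∀ (M q : ℕ), 0 < M → q.Prime → ¬ q ∣ M → ConjSpanGen M q) :
    ∀ (W : WeierstrassCurve ℚ) [W.IsElliptic] [W.IsGloballyMinimal] (p : ℕ) [Fact p.Prime],
      p ≠ 2 → W.HasGoodReductionAtPrime p → W.HasIrreducibleModPGaloisRep p →
        CycWindingNonConstantAt W p :=
  fun W _ _ p _ hp2 hgood hirr ↦ cycWindingNonConstantAt_of_irreducible_of_conjSpanGen W p hp2 hgood hirr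
    fun M hM hpM ↦ hB M p hM Fact.out hpM

end Curves

end Summit.BirchSwinnertonDyer.BirchSwinnertonDyer.Theorems.PrintX8VerticalStevens

end
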